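import Mathlib
import Literature.RepresentationTheory.FiniteGroups.KLRGradedCellularBasis

/-!
# The incomparable-pair sum of a standard Young tableau is a shape functional

Stub `stub_swPairs_add_nePairs` of line `klr-graded-polynomial-method` (crux
`SnSubsetDichotomy.NoThresholdSubsetTriple`, stmt-MatrixMultiplication-8302).

For a standard Young tableau `T` of shape `μ ⊢ n` whose entry `k` sits in the cell
`T.1 k = (r_k, c_k)`, with sign `π_k = (-1)^(r_k + c_k)`, put
`S⁺(T) = Σ_{j < k, cell j strictly south-west of cell k} π_j π_k` and
`S⁻(T) = Σ_{j < k, cell j strictly north-east of cell k} π_j π_k`.  Then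

  `2 (S⁺(T) + S⁻(T)) = ξ² + n − 2 n_ee`,

`ξ = c₀ − c₁` (`c_i` the number of cells of `2`-residue `i`), `n_ee` the number of cells with row and
column both even.

Proof.  (a) For `j < k` the cell of `j` is never weakly south-east of the cell of `k` (standardness),
so it is weakly north-west, strictly south-west or strictly north-east of it: the sum over all pairs
`j < k` of `π_j π_k` is `NW + S⁺ + S⁻` (`pairs_split`).  (b) `2 Σ_{j < k} π_j π_k = (Σ_k π_k)² − n`
(`two_mul_pairSum`, `π² = 1`) and `Σ_k π_k = c₀ − c₁` (`sign_sum`: residue `0` means equal parities).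
(c) For the cell `y = (r, c)` of `k`, the cells of the entries `j < k` weakly north-west of `y` are
exactly the cells `≠ y` of the rectangle `[0, r] × [0, c]` (`pairs_sum_nw`, the diagram being a lower
set filled bijectively and increasingly), whose signed count is `[r even][c even] − 1` (`rect_signSum`);
summing over `k` gives `NW = n_ee − n` (`nw_sum`).  (d) `2 (S⁺ + S⁻) = (ξ² − n) − 2 (n_ee − n)`.
-/

namespace Summit.MatrixMultiplication.MatrixMultiplication.Theorems

open Literature.RepresentationTheory.FiniteGroups (residueContent cellResidue)
open Literature.NumberTheory.DiophantineGeometry (StdFilling)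
open scoped BigOperators

/-- `Σ_{i ≤ m} (−1)^i = [m even]`. [folklore] -/
private theorem altSum_range (m : ℕ) :
    ∑ i ∈ Finset.range (m + 1), (-1 : ℤ) ^ i = if m % 2 = 0 then 1 else 0 := by
  induction m with
  | zero => simp
  | succ m ih =>
    rw [Finset.sum_range_succ, ih, pow_succ]
    rcases Nat.even_or_odd m with hm | hm
    · have hm' := Nat.even_iff.1 hm
      rw [hm.neg_one_pow]
      split_ifs <;> omega
    · have hm' := Nat.odd_iff.1 hm
      rw [hm.neg_one_pow]
      split_ifs <;> omega

/-- The signed count of the rectangle `[0, r] × [0, c]` against its corner: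
`Σ_{p ≤ r, q ≤ c} (−1)^(p + q + r + c) = [r even][c even]`. [folklore] -/
private theorem rect_signSum (r c : ℕ) :
    ∑ x ∈ Finset.range (r + 1) ×ˢ Finset.range (c + 1), (-1 : ℤ) ^ (x.1 + x.2 + r + c) =
      if r % 2 = 0 ∧ c % 2 = 0 then 1 else 0 := by
  have h : ∀ x : ℕ × ℕ, (-1 : ℤ) ^ (x.1 + x.2 + r + c) =
      (-1 : ℤ) ^ x.1 * (-1 : ℤ) ^ x.2 * ((-1 : ℤ) ^ r * (-1 : ℤ) ^ c) := by
    intro x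
    rw [← pow_add, ← pow_add, ← pow_add, ← add_assoc]
  rw [Finset.sum_congr rfl fun x _ => h x, ← Finset.sum_mul, Finset.sum_product,
    ← Finset.sum_mul_sum, altSum_range, altSum_range]
  rcases Nat.even_or_odd r with hr | hr <;> rcases Nat.even_or_odd c with hc | hc
  · have hr' := Nat.even_iff.1 hr
    have hc' := Nat.even_iff.1 hc
    rw [hr.neg_one_pow, hc.neg_one_pow, if_pos hr', if_pos hc', if_pos ⟨hr', hc'⟩]
    norm_num
  · have hc' := Nat.odd_iff.1 hc
    rw [if_neg (by omega : ¬ c % 2 = 0), if_neg (fun h : r % 2 = 0 ∧ c % 2 = 0 => by omega)]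
    ring
  · have hr' := Nat.odd_iff.1 hr
    rw [if_neg (by omega : ¬ r % 2 = 0), if_neg (fun h : r % 2 = 0 ∧ c % 2 = 0 => by omega)]
    ring
  · have hr' := Nat.odd_iff.1 hr
    rw [if_neg (by omega : ¬ r % 2 = 0), if_neg (fun h : r % 2 = 0 ∧ c % 2 = 0 => by omega)]
    ring

-- adapted from Summits/MatrixMultiplication/MatrixMultiplication/Theorems/SnSubsetDichotomyNoThresholdSubsetTripleSwPairs.lean
/-- For `j < k`, the entries `j` whose cell is weakly north-west of the cell `y` of `k` occupy exactly
the cells `≠ y` of the rectangle spanned by `y` (the diagram is a lower set, the filling is increasing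
and bijective): re-indexing of the corresponding sums. [folklore] -/
private theorem pairs_sum_nw {n : ℕ} {μ : Nat.Partition n} (T : StdFilling n μ.youngDiagram)
    (k : Fin n) (F : ℕ × ℕ → ℤ) :
    ∑ j ∈ Finset.univ.filter (fun j : Fin n => j < k ∧ T.1 j ≤ T.1 k), F (T.1 j) =
      ∑ x ∈ (Finset.range ((T.1 k).1 + 1) ×ˢ Finset.range ((T.1 k).2 + 1)).erase (T.1 k), F x := by
  refine Finset.sum_nbij T.1 ?_ T.injective.injOn ?_ (fun _ _ => rfl)
  · intro j hj
    obtain ⟨hjk, hle⟩ := (Finset.mem_filter.1 hj).2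
    rw [Prod.le_def] at hle
    rw [Finset.mem_erase, Finset.mem_product, Finset.mem_range, Finset.mem_range]
    exact ⟨fun h => absurd (T.injective h) (ne_of_lt hjk), by omega, by omega⟩
  · intro x hx
    have hx' := Finset.mem_coe.1 hx
    rw [Finset.mem_erase, Finset.mem_product, Finset.mem_range, Finset.mem_range] at hx'
    obtain ⟨hne, hx1, hx2⟩ := hx'
    have hle : x ≤ T.1 k := Prod.le_def.2 ⟨by omega, by omega⟩
    have hxμ : x ∈ μ.youngDiagram := μ.youngDiagram.isLowerSet hle (T.mem k)
    obtain ⟨j, hj⟩ := T.exists_eq μ.card_cells_youngDiagram hxμ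
    have hlt : j < k := by
      rcases lt_trichotomy j k with h | rfl | h
      · exact h
      · exact absurd hj.symm hne
      · exact absurd (hj ▸ hle) (T.not_le h)
    exact ⟨j, Finset.mem_coe.2 (Finset.mem_filter.2 ⟨Finset.mem_univ _, hlt, hj ▸ hle⟩), hj⟩

/-- The weakly-north-west part of the pair sum at the entry `k` with cell `(r, c)` is
`[r even ∧ c even] − 1` (rectangle minus its corner). [folklore] -/
private theorem nw_entry {n : ℕ} {μ : Nat.Partition n} (T : StdFilling n μ.youngDiagram)
    (k : Fin n) :
    ∑ j ∈ Finset.univ.filter (fun j : Fin n => j < k ∧ T.1 j ≤ T.1 k),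
        (-1 : ℤ) ^ ((T.1 j).1 + (T.1 j).2 + (T.1 k).1 + (T.1 k).2) =
      (if (T.1 k).1 % 2 = 0 ∧ (T.1 k).2 % 2 = 0 then (1 : ℤ) else 0) - 1 := by
  have hNW := pairs_sum_nw T k
    (fun x : ℕ × ℕ => (-1 : ℤ) ^ (x.1 + x.2 + (T.1 k).1 + (T.1 k).2))
  beta_reduce at hNW
  have hsq : (-1 : ℤ) ^ ((T.1 k).1 + (T.1 k).2 + (T.1 k).1 + (T.1 k).2) = 1 :=
    Even.neg_one_pow ⟨(T.1 k).1 + (T.1 k).2, by ring⟩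
  rw [hNW, Finset.sum_erase_eq_sub (Finset.mem_product.2
      ⟨Finset.mem_range.2 (Nat.lt_succ_self _), Finset.mem_range.2 (Nat.lt_succ_self _)⟩),
    rect_signSum, hsq]

/-- Transport of a sum over the entries of a standard Young tableau to a sum over the cells of its
shape (the tableau is a bijection onto the cells). [folklore] -/
private theorem sum_entries_eq_sum_cells {n : ℕ} {μ : Nat.Partition n}
    (T : StdFilling n μ.youngDiagram) (F : ℕ × ℕ → ℤ) :
    ∑ k : Fin n, F (T.1 k) = ∑ x ∈ μ.youngDiagram.cells, F x := by
  refine Finset.sum_nbij T.1 (fun k _ => (YoungDiagram.mem_cells _).2 (T.mem k))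
    T.injective.injOn ?_ (fun _ _ => rfl)
  intro x hx
  obtain ⟨j, hj⟩ := T.exists_eq μ.card_cells_youngDiagram
    ((YoungDiagram.mem_cells _).1 (Finset.mem_coe.1 hx))
  exact ⟨j, Finset.mem_coe.2 (Finset.mem_univ _), hj⟩

/-- **The comparable pairs.** `Σ_k Σ_{j < k, cell j weakly NW of cell k} π_j π_k = n_ee − n`.
[folklore] -/
private theorem nw_sum {n : ℕ} {μ : Nat.Partition n} (T : StdFilling n μ.youngDiagram) :
    ∑ k : Fin n, ∑ j ∈ Finset.univ.filter (fun j : Fin n => j < k ∧ T.1 j ≤ T.1 k),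
        (-1 : ℤ) ^ ((T.1 j).1 + (T.1 j).2 + (T.1 k).1 + (T.1 k).2) =
      ((μ.youngDiagram.cells.filter (fun c : ℕ × ℕ => c.1 % 2 = 0 ∧ c.2 % 2 = 0)).card : ℤ) - n := by
  rw [Finset.sum_congr rfl fun k _ => nw_entry T k, Finset.sum_sub_distrib, Finset.natCast_card_filter,
    ← sum_entries_eq_sum_cells T (fun x : ℕ × ℕ => if x.1 % 2 = 0 ∧ x.2 % 2 = 0 then (1 : ℤ) else 0)]
  simp

/-- `res₂ x = 0 ↔` row and column have the same parity. [folklore] -/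
private theorem cellResidue_two_eq_zero_iff' (x : ℕ × ℕ) :
    cellResidue 2 x = 0 ↔ x.2 % 2 = x.1 % 2 := by
  unfold cellResidue
  rw [sub_eq_zero, ZMod.natCast_eq_natCast_iff']

/-- `res₂ x = 1 ↔` row and column have different parities. [folklore] -/
private theorem cellResidue_two_eq_one_iff' (x : ℕ × ℕ) :
    cellResidue 2 x = 1 ↔ ¬ x.2 % 2 = x.1 % 2 := by
  rw [← cellResidue_two_eq_zero_iff']
  have hz : ∀ z : ZMod 2, z = 1 ↔ ¬ z = 0 := by decide
  exact hz _

/-- **The total sign.** `Σ_k π_k = c₀ − c₁`: a cell has `2`-residue `0` iff its row and column have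
the same parity, iff its sign is `+1`. [folklore] -/
private theorem sign_sum {n : ℕ} {μ : Nat.Partition n} (T : StdFilling n μ.youngDiagram) :
    ∑ k : Fin n, (-1 : ℤ) ^ ((T.1 k).1 + (T.1 k).2) =
      (residueContent 2 μ 0 : ℤ) - (residueContent 2 μ 1 : ℤ) := by
  unfold residueContent
  rw [Finset.natCast_card_filter, Finset.natCast_card_filter, ← Finset.sum_sub_distrib,
    sum_entries_eq_sum_cells T (fun x : ℕ × ℕ => (-1 : ℤ) ^ (x.1 + x.2))]
  refine Finset.sum_congr rfl fun x _ => ?_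
  simp only [cellResidue_two_eq_zero_iff', cellResidue_two_eq_one_iff']
  rw [neg_one_pow_eq_pow_mod_two, Nat.add_mod]
  have h1 := Nat.mod_two_eq_zero_or_one x.1
  have h2 := Nat.mod_two_eq_zero_or_one x.2
  rcases h1 with h1 | h1 <;> rcases h2 with h2 | h2 <;> simp [h1, h2]

/-- **Trichotomy.** For `j < k` the cell of `j` is weakly north-west, strictly south-west or strictly
north-east of the cell of `k` (never weakly south-east, by standardness): the pair sum at `k` splits
accordingly. [folklore] -/
private theorem pairs_split {n : ℕ} {μ : Nat.Partition n} (T : StdFilling n μ.youngDiagram)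
    (k : Fin n) :
    ∑ j ∈ Finset.univ.filter (fun j : Fin n => j < k),
        (-1 : ℤ) ^ ((T.1 j).1 + (T.1 j).2 + (T.1 k).1 + (T.1 k).2) =
      ∑ j ∈ Finset.univ.filter (fun j : Fin n => j < k ∧ T.1 j ≤ T.1 k),
          (-1 : ℤ) ^ ((T.1 j).1 + (T.1 j).2 + (T.1 k).1 + (T.1 k).2) +
        ∑ j ∈ Finset.univ.filter
            (fun j : Fin n => j < k ∧ (T.1 k).1 < (T.1 j).1 ∧ (T.1 j).2 < (T.1 k).2),
          (-1 : ℤ) ^ ((T.1 j).1 + (T.1 j).2 + (T.1 k).1 + (T.1 k).2) +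
        ∑ j ∈ Finset.univ.filter
            (fun j : Fin n => j < k ∧ (T.1 j).1 < (T.1 k).1 ∧ (T.1 k).2 < (T.1 j).2),
          (-1 : ℤ) ^ ((T.1 j).1 + (T.1 j).2 + (T.1 k).1 + (T.1 k).2) := by
  rw [Finset.sum_filter, Finset.sum_filter, Finset.sum_filter, Finset.sum_filter,
    ← Finset.sum_add_distrib, ← Finset.sum_add_distrib]
  refine Finset.sum_congr rfl fun j _ => ?_
  by_cases hjk : j < k
  · have hkj : ¬ T.1 k ≤ T.1 j := T.not_le hjk
    rw [Prod.le_def, not_and_or, not_le, not_le] at hkj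
    by_cases hle : T.1 j ≤ T.1 k
    · have hle' := Prod.le_def.1 hle
      rw [if_pos hjk, if_pos ⟨hjk, hle⟩, if_neg (fun h => absurd hle'.1 (not_le.2 h.2.1)),
        if_neg (fun h => absurd hle'.2 (not_le.2 h.2.2)), add_zero, add_zero]
    · rw [if_pos hjk, if_neg (fun h => hle h.2), zero_add]
      rw [Prod.le_def, not_and_or, not_le, not_le] at hle
      by_cases hsw : (T.1 k).1 < (T.1 j).1 ∧ (T.1 j).2 < (T.1 k).2
      · rw [if_pos ⟨hjk, hsw⟩, if_neg (fun h => absurd hsw.1 (not_lt.2 (le_of_lt h.2.1))),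
          add_zero]
      · rw [if_neg (fun h => hsw h.2), zero_add]
        rw [not_and_or, not_lt, not_lt] at hsw
        rw [if_pos ⟨hjk, by omega, by omega⟩]
  · rw [if_neg hjk, if_neg (fun h => hjk h.1), if_neg (fun h => hjk h.1),
      if_neg (fun h => hjk h.1), add_zero, add_zero]

/-- **All pairs.** `2 Σ_k Σ_{j < k} a_j a_k = (Σ_k a_k)² − Σ_k a_k²`. [folklore] -/
private theorem two_mul_pairSum {n : ℕ} (a : Fin n → ℤ) :
    2 * ∑ k : Fin n, ∑ j ∈ Finset.univ.filter (fun j : Fin n => j < k), a j * a k =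
      (∑ k : Fin n, a k) ^ 2 - ∑ k : Fin n, a k * a k := by
  -- split `Σ_j a_j a_k` by the position of `j` relative to `k`
  have hsplit : ∀ k : Fin n, ∑ j : Fin n, a j * a k =
      ∑ j : Fin n, (if j < k then a j * a k else 0) + a k * a k +
        ∑ j : Fin n, (if k < j then a j * a k else 0) := by
    intro k
    have hpt : ∀ j : Fin n, a j * a k = (if j < k then a j * a k else 0) +
        (if j = k then a j * a k else 0) + (if k < j then a j * a k else 0) := by
      intro j
      rcases lt_trichotomy j k with h | rfl | h
      · rw [if_pos h, if_neg (ne_of_lt h), if_neg (not_lt.2 h.le)]; ring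
      · rw [if_neg (lt_irrefl _), if_pos rfl]; ring
      · rw [if_neg (not_lt.2 h.le), if_neg (ne_of_gt h), if_pos h]; ring
    rw [Finset.sum_congr rfl fun j _ => hpt j, Finset.sum_add_distrib, Finset.sum_add_distrib,
      Finset.sum_ite_eq_of_mem' _ _ _ (Finset.mem_univ k)]
  -- the upper part equals the lower part (swap the summations)
  have hupper : ∑ k : Fin n, ∑ j : Fin n, (if k < j then a j * a k else 0) =
      ∑ k : Fin n, ∑ j : Fin n, (if j < k then a j * a k else 0) := by
    rw [Finset.sum_comm]
    refine Finset.sum_congr rfl fun k _ => Finset.sum_congr rfl fun j _ => ?_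
    split_ifs
    · ring
    · rfl
  have hsq : (∑ k : Fin n, a k) ^ 2 = ∑ k : Fin n, ∑ j : Fin n, a j * a k := by
    rw [sq, Finset.sum_mul_sum, Finset.sum_comm]
  rw [hsq, Finset.sum_congr rfl fun k _ => hsplit k, Finset.sum_add_distrib,
    Finset.sum_add_distrib, hupper]
  simp only [Finset.sum_filter]
  ring

set_option linter.dupNamespace false in -- deliberate Summit.<S>.<P> duplicate
/-- **The incomparable-pair sum of a standard Young tableau is a shape functional.**
For `T` standard of shape `μ ⊢ n`, with `π_i = (−1)^(row + col of the cell of i)`,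
`S⁺(T) = Σ_{j < k, cell j strictly SW of cell k} π_j π_k` and
`S⁻(T) = Σ_{j < k, cell j strictly NE of cell k} π_j π_k`:
`2 (S⁺(T) + S⁻(T)) = (c₀ − c₁)² + n − 2 n_ee`, where `c_i` is the number of cells of `μ` of
`2`-residue `i` and `n_ee` the number of cells with row and column both even.  Indeed
`Σ_{j < k} π_j π_k = NW + S⁺ + S⁻` (trichotomy, `pairs_split`), `2 Σ_{j < k} π_j π_k = (c₀ − c₁)² − n`
(`two_mul_pairSum`, `sign_sum`) and `NW = n_ee − n` (`nw_sum`: the comparable smaller cells of a cell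
`(r, c)` fill the rectangle `[0, r] × [0, c]`, of signed count `[r even][c even]`). [folklore] -/
theorem stub_swPairs_add_nePairs : ∀ (n : ℕ) (μ : Nat.Partition n) (T : StdFilling n μ.youngDiagram), 2 * ((∑ k : Fin n, ∑ j ∈ Finset.univ.filter (fun j : Fin n => j < k ∧ (T.1 k).1 < (T.1 j).1 ∧ (T.1 j).2 < (T.1 k).2), (-1 : ℤ) ^ ((T.1 j).1 + (T.1 j).2 + (T.1 k).1 + (T.1 k).2)) + (∑ k : Fin n, ∑ j ∈ Finset.univ.filter (fun j : Fin n => j < k ∧ (T.1 j).1 < (T.1 k).1 ∧ (T.1 k).2 < (T.1 j).2), (-1 : ℤ) ^ ((T.1 j).1 + (T.1 j).2 + (T.1 k).1 + (T.1 k).2))) = ((residueContent 2 μ 0 : ℤ) - (residueContent 2 μ 1 : ℤ)) ^ 2 + (n : ℤ) - 2 * ((μ.youngDiagram.cells.filter (fun c : ℕ × ℕ => c.1 % 2 = 0 ∧ c.2 % 2 = 0)).card : ℤ) := by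
  intro n μ T
  -- (a) trichotomy, summed over `k`
  have hall : ∑ k : Fin n, ∑ j ∈ Finset.univ.filter (fun j : Fin n => j < k),
        (-1 : ℤ) ^ ((T.1 j).1 + (T.1 j).2 + (T.1 k).1 + (T.1 k).2) =
      ∑ k : Fin n, ∑ j ∈ Finset.univ.filter (fun j : Fin n => j < k ∧ T.1 j ≤ T.1 k),
          (-1 : ℤ) ^ ((T.1 j).1 + (T.1 j).2 + (T.1 k).1 + (T.1 k).2) +
        ∑ k : Fin n, ∑ j ∈ Finset.univ.filter
            (fun j : Fin n => j < k ∧ (T.1 k).1 < (T.1 j).1 ∧ (T.1 j).2 < (T.1 k).2),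
          (-1 : ℤ) ^ ((T.1 j).1 + (T.1 j).2 + (T.1 k).1 + (T.1 k).2) +
        ∑ k : Fin n, ∑ j ∈ Finset.univ.filter
            (fun j : Fin n => j < k ∧ (T.1 j).1 < (T.1 k).1 ∧ (T.1 k).2 < (T.1 j).2),
          (-1 : ℤ) ^ ((T.1 j).1 + (T.1 j).2 + (T.1 k).1 + (T.1 k).2) := by
    rw [← Finset.sum_add_distrib, ← Finset.sum_add_distrib]
    exact Finset.sum_congr rfl fun k _ => pairs_split T k
  -- (b) all pairs: `2 Σ_{j<k} π_j π_k = (Σ π)² − n`, `Σ π = c₀ − c₁`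
  have hpair := two_mul_pairSum (fun k : Fin n => (-1 : ℤ) ^ ((T.1 k).1 + (T.1 k).2))
  beta_reduce at hpair
  have hdiag : ∑ k : Fin n, (-1 : ℤ) ^ ((T.1 k).1 + (T.1 k).2) * (-1 : ℤ) ^ ((T.1 k).1 + (T.1 k).2) =
      n := by
    rw [Finset.sum_congr rfl fun k _ =>
      ((pow_add (-1 : ℤ) _ _).symm.trans (Even.neg_one_pow ⟨(T.1 k).1 + (T.1 k).2, rfl⟩))]
    simp
  have hprod : ∀ j k : Fin n,
      (-1 : ℤ) ^ ((T.1 j).1 + (T.1 j).2) * (-1 : ℤ) ^ ((T.1 k).1 + (T.1 k).2) =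
        (-1 : ℤ) ^ ((T.1 j).1 + (T.1 j).2 + (T.1 k).1 + (T.1 k).2) := by
    intro j k
    rw [← pow_add, ← add_assoc]
  rw [hdiag, sign_sum T] at hpair
  simp only [hprod] at hpair
  rw [hall] at hpair
  -- (c) the comparable pairs, (d) assemble
  have hnw := nw_sum T
  linear_combination hpair - 2 * hnw

end Summit.MatrixMultiplication.MatrixMultiplication.Theorems
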